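import Literature.NumberTheory.Weil1965.ThetaIntegralHermNormSplit
import Literature.NumberTheory.Weil1964.AdelicChirpBlockSum
import HarnessLib

/-!
# The hermitian norm of the doubled theta carrier IS the global second-degree form `q_{C₀}`

Topic `NumberTheory/Weil1965`; namespace `Literature.NumberTheory.Weil1965.UnitaryDoubling` (sequel of
★ `ThetaIntegralHermNormSplit`).  KERNEL mathematics only: theorems (no `def`, no named fact, no `sorry`).

For the doubled unitary dual pair `(U(J_V), U(W ⊕ W⁻))` of the cell's E-2 Siegel–Weil line, Weil's invariant `i_X` of the doubled
carrier `X□(𝔸) = 𝔸_F^{n+n}` is ★ `hNorm` (`ThetaIntegralOrbitFunctionalUnitary`), and ★ `hNorm_eq_sub_dotProduct` computes it as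
`x¹ ⬝ᵥ 𝕋 x¹ − d · x² ⬝ᵥ 𝕋⁻¹ x²` (`𝕋 = adelicGram F e T_V T_W`).  The Eisenstein side of the line (★ `Theorems/H413E2SWEisDecomposition`,
★ `AdelicSiegelFunctional*`) is written over the GLOBAL rational symmetric matrix
`C₀ := reindex finSumFinEquiv finSumFinEquiv (gram ⊕ −d·gram⁻¹) ∈ M_{n+n}(F)` through the second-degree form
`q_{C₀} = sdForm F (ratMatrix F C₀)` (★ `AdelicSecondDegreeCharacter`).  This file is the bridge:

* `ratMatrix_reindex_gram_blocks` — `ratMatrix F C₀ = reindex finSumFinEquiv finSumFinEquiv (𝕋 ⊕ −(ι d)·𝕋⁻¹)` over `𝔸_F`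
  (`(gram⁻¹) ⊗ 1 = 𝕋⁻¹` since `det gram` is a unit, ★ `isUnit_det_gram`);
* `sdForm_ratMatrix_C0` — `q_{C₀}(x) = x¹ ⬝ᵥ 𝕋 x¹ − (ι d) · x² ⬝ᵥ 𝕋⁻¹ x²` (★ `sdForm_reindex_fromBlocks'`, ★ `sdForm_smul`);
* **`hNorm_eq_sdForm_C0`** — `hNorm x = sdForm F (ratMatrix F C₀) x` for every `x ∈ X□(𝔸)`: the hypothesis `hhS` of the Eisenstein
  decomposition and of the (E_X) junction, discharged.

References: A. Weil, *Sur la formule de Siegel dans la théorie des groupes classiques*, Acta Math. 113 (1965), Chap. IV n° 41 (35)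
p. 59 (the invariant `i_X`), n° 46 p. 66; A. Weil, *Sur certains groupes d'opérateurs unitaires*, Acta Math. 111 (1964), Chap. I
n° 13 p. 160 (second-degree forms of block matrices).

Written for the Hodge-CM cell `pub/hodgecm-mathlib`, floor 0, crux H413 (stmt-HodgeConjecture-24833), E-2 child line
`F0_E2SiegelWeilWeilRange`, I-CLOSE/(E_X) row «hhS» (F0P4-plan (g4) 2026-08-31T04:09:06Z; A-p16 (g18)).
HC_CM is proved only modulo the printed citations until rung 0 closes; this file discharges none of them.
-/

set_option autoImplicit false

noncomputable section

open scoped Matrix Kronecker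
open NumberField IsDedekindDomain Matrix

namespace Literature.NumberTheory.Weil1965.UnitaryDoubling

open Literature.NumberTheory.Automorphic Literature.NumberTheory.Automorphic.UnitaryGroup
open Literature.NumberTheory.GelbartRogawski1991
open Literature.NumberTheory.Weil1964

variable (F E : Type) [Field F] [NumberField F] [Field E] [NumberField E] [Algebra F E] [Algebra.IsQuadraticExtension F E]
  (c : E ≃ₐ[F] E) {δ : E} (hcδ : c δ = -δ) (hδ : δ ≠ 0) {d : F} (hd : δ * δ = algebraMap F E d)
  (N : ℕ) {n : ℕ} (e : Fin N × Fin 1 ≃ Fin n)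
  (TV : Matrix (Fin N) (Fin N) F) (hV : TV.IsSymm) (hVd : IsUnit TV.det)
  (TW : Matrix (Fin 1) (Fin 1) F) (hW : TW.IsSymm) (hWd : IsUnit TW.det)

/-- a ring map takes the inverse of an invertible matrix to the inverse. [folklore] -/
private theorem map_nonsing_inv_of_isUnit' {R S : Type*} [CommRing R] [CommRing S] {m : Type*} [Fintype m] [DecidableEq m]
    (f : R →+* S) {G : Matrix m m R} (hG : IsUnit G.det) : (G⁻¹).map f = (G.map f)⁻¹ := by
  symm
  refine Matrix.inv_eq_right_inv ?_
  rw [← Matrix.map_mul, Matrix.mul_nonsing_inv G hG, Matrix.map_one f (map_zero f) (map_one f)]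

omit [NumberField F] in
/-- entrywise maps commute with `reindex`. [folklore] -/
private theorem reindex_map' {R S : Type*} (f : R → S) {l m : Type*} (eq : l ≃ m) (M : Matrix l l R) :
    (Matrix.reindex eq eq M).map f = Matrix.reindex eq eq (M.map f) := rfl

include hVd hWd in
omit [Algebra.IsQuadraticExtension F E] in
/-- **`ratMatrix F C₀ = 𝕋 ⊕ −(ι d)·𝕋⁻¹` over `𝔸_F`** (`𝕋 = adelicGram = gram ⊗ 1`, `(gram⁻¹) ⊗ 1 = 𝕋⁻¹`).
[cite: Weil1965, Chap. IV n° 41, (35) p. 59] -/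
theorem ratMatrix_reindex_gram_blocks :
    ratMatrix F (Matrix.reindex finSumFinEquiv finSumFinEquiv
        (Matrix.fromBlocks (UnitaryDualPair.gram F e TV TW) 0 0 (-(d • (UnitaryDualPair.gram F e TV TW)⁻¹)))) =
      Matrix.reindex finSumFinEquiv finSumFinEquiv
        (Matrix.fromBlocks (UnitaryDualPair.adelicGram F e TV TW) 0 0
          (-(algebraMap F (AdeleRing (𝓞 F) F) d • (UnitaryDualPair.adelicGram F e TV TW)⁻¹))) := by
  rw [Weil1964.ratMatrix, reindex_map', Matrix.fromBlocks_map, UnitaryDualPair.adelicGram_eq_map,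
    ← map_nonsing_inv_of_isUnit' _ (UnitaryDualPair.isUnit_det_gram F e hVd hWd)]
  have h0 : (0 : Matrix (Fin n) (Fin n) F).map (algebraMap F (AdeleRing (𝓞 F) F)) = 0 :=
    Matrix.map_zero _ (map_zero _)
  have hD : (-(d • (UnitaryDualPair.gram F e TV TW)⁻¹)).map (algebraMap F (AdeleRing (𝓞 F) F)) =
      -(algebraMap F (AdeleRing (𝓞 F) F) d • ((UnitaryDualPair.gram F e TV TW)⁻¹).map (algebraMap F (AdeleRing (𝓞 F) F))) := by
    ext i j
    simp only [Matrix.map_apply, Matrix.neg_apply, Matrix.smul_apply, smul_eq_mul, map_neg, map_mul]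
  rw [h0, hD]

include hVd hWd in
omit [Algebra.IsQuadraticExtension F E] in
/-- **`q_{C₀}(x) = x¹ ⬝ᵥ 𝕋 x¹ − (ι d) · x² ⬝ᵥ 𝕋⁻¹ x²`** (`x¹ = x ∘ castAdd`, `x² = x ∘ natAdd`): the global second-degree form of
`C₀` in block coordinates. [cite: Weil1964, Chap. I n° 13 p. 160] [cite: Weil1965, Chap. IV n° 41, (35) p. 59] -/
theorem sdForm_ratMatrix_C0 (x : Fin (n + n) → AdeleRing (𝓞 F) F) :
    sdForm F (ratMatrix F (Matrix.reindex finSumFinEquiv finSumFinEquiv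
        (Matrix.fromBlocks (UnitaryDualPair.gram F e TV TW) 0 0 (-(d • (UnitaryDualPair.gram F e TV TW)⁻¹))))) x =
      (fun i => x (Fin.castAdd n i)) ⬝ᵥ UnitaryDualPair.adelicGram F e TV TW *ᵥ (fun i => x (Fin.castAdd n i)) -
        algebraMap F (AdeleRing (𝓞 F) F) d *
          ((fun i => x (Fin.natAdd n i)) ⬝ᵥ (UnitaryDualPair.adelicGram F e TV TW)⁻¹ *ᵥ fun i => x (Fin.natAdd n i)) := by
  rw [ratMatrix_reindex_gram_blocks F N e TV hVd TW hWd, sdForm_reindex_fromBlocks', Matrix.vecMul_zero, zero_dotProduct,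
    Matrix.vecMul_zero, zero_dotProduct, add_zero, add_zero, ← neg_smul, sdForm_smul, sdForm_apply, sdForm_apply,
    ← Matrix.dotProduct_mulVec, ← Matrix.dotProduct_mulVec]
  ring

include hd in
/-- **`hNorm = q_{C₀}`: the hermitian norm of the doubled theta carrier IS the global second-degree form of
`C₀ = reindex (gram ⊕ −d·gram⁻¹)`** — the hypothesis `hhS` of ★ `Theorems/H413E2SWEisDecomposition` and of the (E_X) junction.
[cite: Weil1965, Chap. IV n° 41, (35) p. 59] -/
theorem hNorm_eq_sdForm_C0 (x : Fin (n + n) → AdeleRing (𝓞 F) F) :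
    hNorm F E c hcδ hδ N e TV hVd TW hWd x =
      sdForm F (ratMatrix F (Matrix.reindex finSumFinEquiv finSumFinEquiv
        (Matrix.fromBlocks (UnitaryDualPair.gram F e TV TW) 0 0 (-(d • (UnitaryDualPair.gram F e TV TW)⁻¹))))) x := by
  rw [hNorm_eq_sub_dotProduct F E c hcδ hδ hd N e TV hVd TW hWd, sdForm_ratMatrix_C0 F N e TV hVd TW hWd]

include hd in
/-- the same as an equality of functions `X□(𝔸) → 𝔸_F` (the shape `h = q_{C₀}` consumed by the fibre-measure files).
[cite: Weil1965, Chap. IV n° 41, (35) p. 59] -/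
theorem hNorm_eq_sdForm_C0' :
    hNorm F E c hcδ hδ N e TV hVd TW hWd =
      sdForm F (ratMatrix F (Matrix.reindex finSumFinEquiv finSumFinEquiv
        (Matrix.fromBlocks (UnitaryDualPair.gram F e TV TW) 0 0 (-(d • (UnitaryDualPair.gram F e TV TW)⁻¹))))) :=
  funext (hNorm_eq_sdForm_C0 F E c hcδ hδ hd N e TV hVd TW hWd)

end Literature.NumberTheory.Weil1965.UnitaryDoubling

end
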